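import Mathlib
import Literature.Analysis.Convex.MatrixStarAlgebraPSD
import Literature.Algebra.Polynomial.PutinarPositivstellensatz
import HarnessLib

/-!
# The Gram-matrix method: sums of squares of polynomials and positive semidefinite matrices

The observation behind every semidefinite-programming search for sum-of-squares (SOS)
certificates (Choi–Lam–Reznick; Powers–Wörmann; Parrilo; Laurent's survey [Laurent2008, §3.3
Lemma 3.8 "Recognizing sums of squares"]; Peyrl–Parrilo [PeyrlParrilo2008, Thm 2, Prop. 4, Thm 6]
for the exact rational variant): a polynomial `p` of degree `≤ 2d` in `n` variables is a sum of
squares of polynomials **iff** `p = z_dᵀ Q z_d` for some POSITIVE SEMIDEFINITE matrix `Q`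
indexed by the monomials of degree `≤ d` (`z_d` = the vector of these monomials), i.e. iff the
linear system "`Σ_{β+γ=α} Q_{βγ} = p_α` for all `|α| ≤ 2d`" [Laurent2008, (3.4)] has a PSD
solution — a semidefinite feasibility problem.  Any factorisation `Q = Bᵀ B` (or `Q = Σ_l d_l v_l v_lᵀ`
with `d_l ≥ 0`, e.g. from an exact `LDLᵀ` decomposition [PeyrlParrilo2008, Thm 6]) turns `Q` into
an explicit (weighted) SOS decomposition, and conversely the coefficient vectors of the squared
polynomials assemble into such a `B`.

## Contents (namespace `Literature.Algebra.Polynomial.GramMatrixMethod`)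

Over a commutative semiring `R`, for `Q : Matrix k k R` and `z : k → MvPolynomial σ R`:
* `gramPoly Q z = Σ_i Σ_j Q_{ij} · z_i z_j` (`= z ⬝ᵥ (Q.map C) *ᵥ z`, `gramPoly_eq_dotProduct`);
  `eval_gramPoly` : its value at `x` is the quadratic form `z(x)ᵀ Q z(x)`.
* `gramPoly_transpose_mul_self` : `gramPoly (Bᵀ B) z = Σ_l (Σ_j B_{lj} z_j)²`, hence
  `isSumSq_gramPoly_transpose_mul_self` [PeyrlParrilo2008, Thm 2 (ii)⇒(i)];
  `gramPoly_sum_smul_vecMulVec` : `gramPoly (Σ_l d_l • v_l v_lᵀ) z = Σ_l d_l (v_l · z)²` — the `LDLᵀ`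
  shape — with `isSumSq_gramPoly_sum_smul_vecMulVec` (weights that are sums of squares) and, over an
  ordered ring, `eval_gramPoly_sum_smul_vecMulVec_nonneg` (weights `≥ 0`) [PeyrlParrilo2008, proof
  of Prop. 4 and Thm 6].
* `eval_gramPoly_nonneg_of_posSemidef` : over an ordered commutative ring with trivial star, a PSD
  `Q` gives `0 ≤ (gramPoly Q z)(x)` for every `x` — the soundness direction a certificate checker
  uses, with no factorisation needed.
* `isSumSq_gramPoly_of_posSemidef` : over `ℝ`, a PSD `Q` gives a genuine sum of squares
  (`Q = Bᴴ B`).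
* The monomial basis: `monomialVec S β = X^β` for `β` in a finite set `S` of exponents;
  `sum_mul_self_eq_gramPoly` : if every `u_j` is supported in `S` then
  `Σ_j u_j² = gramPoly ((coeffMatrix u S)ᵀ (coeffMatrix u S)) (monomialVec S)`
  [Laurent2008, proof of Lemma 3.8]; `coeff_gramPoly_monomialVec` : the coefficients of
  `gramPoly Q (monomialVec S)` are `Σ_{β+γ=α} Q_{βγ}` — the linear system [Laurent2008, (3.4)].
* The degree bound: over a linearly ordered field, `p = Σ_j u_j²` forces `2 · deg u_j ≤ deg p`
  (`two_mul_totalDegree_le_of_sum_mul_self_eq`; top homogeneous components cannot cancel in a sum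
  of squares, since over an ordered field `Σ_j u_j² = 0` forces every `u_j = 0`), and
  `exists_sum_mul_self_eq_of_isSumSq_of_totalDegree_le` : an SOS polynomial of degree `≤ 2d` is a
  sum of squares of polynomials of degree `≤ d`.
* `monomialsLE σ d` : the finite set of exponents of degree `≤ d` in finitely many variables.
* **Lemma 3.8** over `ℝ` (`isSumSq_iff_exists_posSemidef`, `isSumSq_iff_exists_posSemidef_coeff`):
  for `deg p ≤ 2d`, `IsSumSq p ↔ ∃ Q ⪰ 0` on `monomialsLE σ d` with `p = gramPoly Q z_d`
  `↔ ∃ Q ⪰ 0` solving (3.4).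
* `mem_quadraticModule_of_gramPoly` : a Putinar-type certificate written with PSD Gram matrices,
  `p = gramPoly Q₀ z₀ + Σ_i gramPoly Qᵢ zᵢ · gᵢ`, is a membership `p ∈ QM(g)`
  (`Literature.Algebra.Polynomial.PutinarPositivstellensatz.quadraticModule`).

## References

* [Laurent2008] M. Laurent, *Sums of squares, moment matrices and optimization over polynomials*,
  in: Emerging Applications of Algebraic Geometry, IMA Vol. Math. Appl. 149, Springer (2009)
  157–270, §3.3, Lemma 3.8 and system (3.4).
* [PeyrlParrilo2008] H. Peyrl, P. A. Parrilo, *Computing sum of squares decompositions with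
  rational coefficients*, Theoret. Comput. Sci. 409 (2008) 269–281, Thm 2 (Gram matrix), Prop. 4
  (rational Gram matrix ⇒ rational weighted SOS), Thm 6 (`LDLᵀ`).

No named facts; everything here is proved.
-/

noncomputable section

open MvPolynomial Matrix Finset

open scoped BigOperators

namespace Literature.Algebra.Polynomial.GramMatrixMethod

universe u v w

variable {σ : Type u} {R : Type v} {k : Type w} [Fintype k]

/-! ### The Gram polynomial `zᵀ Q z` -/

section Semiring

variable [CommSemiring R]

/-- The **Gram polynomial** of a matrix `Q` and a vector of polynomials `z`:
`gramPoly Q z = Σ_i Σ_j Q_{ij} · (z_i z_j) = z ⬝ᵥ (Q.map C) *ᵥ z`.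
[cite: Laurent2008, §3.3 proof of Lemma 3.8] -/
def gramPoly (Q : Matrix k k R) (z : k → MvPolynomial σ R) : MvPolynomial σ R :=
  ∑ i, ∑ j, C (Q i j) * (z i * z j)

/-- `gramPoly Q z` is the quadratic form `zᵀ (Q.map C) z` of the constant matrix `Q`.
[cite: Laurent2008, §3.3 proof of Lemma 3.8] -/
theorem gramPoly_eq_dotProduct (Q : Matrix k k R) (z : k → MvPolynomial σ R) :
    gramPoly Q z = z ⬝ᵥ (Q.map C) *ᵥ z := by
  simp only [gramPoly, dotProduct, mulVec, Matrix.map_apply, Finset.mul_sum]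
  refine Finset.sum_congr rfl fun i _ => Finset.sum_congr rfl fun j _ => ?_
  ring

/-- **Semantics.** The value of `gramPoly Q z` at a point `x` is the quadratic form of `Q` at the
vector of values `(z_i(x))_i`: `(zᵀQz)(x) = z(x)ᵀ Q z(x)`.
[cite: Laurent2008, §3.3 proof of Lemma 3.8] -/
theorem eval_gramPoly (Q : Matrix k k R) (z : k → MvPolynomial σ R) (x : σ → R) :
    eval x (gramPoly Q z) = (fun i => eval x (z i)) ⬝ᵥ Q *ᵥ (fun i => eval x (z i)) := by
  simp only [gramPoly, map_sum, map_mul, eval_C, dotProduct, mulVec, Finset.mul_sum]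
  refine Finset.sum_congr rfl fun i _ => Finset.sum_congr rfl fun j _ => ?_
  ring

/-- **A Gram factorisation is an SOS decomposition**: `gramPoly (Bᵀ B) z = Σ_l (Σ_j B_{lj} z_j)²`.
[cite: PeyrlParrilo2008, Thm 2, proof of (ii)⇒(i)] -/
theorem gramPoly_transpose_mul_self {r : Type*} [Fintype r] (B : Matrix r k R)
    (z : k → MvPolynomial σ R) :
    gramPoly (Bᵀ * B) z = ∑ l, (∑ j, C (B l j) * z j) * (∑ j, C (B l j) * z j) := by
  classical
  calc gramPoly (Bᵀ * B) z
      = ∑ i, ∑ j, ∑ l, C (B l i) * C (B l j) * (z i * z j) := by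
        simp only [gramPoly, Matrix.mul_apply, Matrix.transpose_apply, map_sum, map_mul,
          Finset.sum_mul]
    _ = ∑ i, ∑ l, ∑ j, C (B l i) * C (B l j) * (z i * z j) :=
        Finset.sum_congr rfl fun i _ => Finset.sum_comm
    _ = ∑ l, ∑ i, ∑ j, C (B l i) * C (B l j) * (z i * z j) := Finset.sum_comm
    _ = ∑ l, (∑ j, C (B l j) * z j) * (∑ j, C (B l j) * z j) := by
        refine Finset.sum_congr rfl fun l _ => ?_
        rw [Finset.sum_mul_sum]
        exact Finset.sum_congr rfl fun i _ => Finset.sum_congr rfl fun j _ => by ring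

/-- Hence `gramPoly (Bᵀ B) z` is a sum of squares of polynomials.
[cite: PeyrlParrilo2008, Thm 2 (ii)⇒(i)] -/
theorem isSumSq_gramPoly_transpose_mul_self {r : Type*} [Fintype r] (B : Matrix r k R)
    (z : k → MvPolynomial σ R) : IsSumSq (gramPoly (Bᵀ * B) z) := by
  rw [gramPoly_transpose_mul_self]
  exact IsSumSq.sum_mul_self _ _

/-- **The `LDLᵀ` shape**: for `Q = Σ_l d_l • v_l v_lᵀ` (e.g. `Q = Lᵀ D L` with the rows `v_l` of
`L` and the pivots `d_l`), `gramPoly Q z = Σ_l d_l · (v_l · z)²`.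
[cite: PeyrlParrilo2008, §3 proof of Prop. 4 and Thm 6] -/
theorem gramPoly_sum_smul_vecMulVec {r : Type*} [Fintype r] (d : r → R) (v : r → k → R)
    (z : k → MvPolynomial σ R) :
    gramPoly (∑ l, d l • vecMulVec (v l) (v l)) z =
      ∑ l, C (d l) * ((∑ j, C (v l j) * z j) * (∑ j, C (v l j) * z j)) := by
  classical
  calc gramPoly (∑ l, d l • vecMulVec (v l) (v l)) z
      = ∑ i, ∑ j, ∑ l, C (d l) * (C (v l i) * C (v l j)) * (z i * z j) := by
        simp only [gramPoly, Matrix.sum_apply, Matrix.smul_apply, vecMulVec_apply, smul_eq_mul,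
          map_sum, map_mul, Finset.sum_mul]
    _ = ∑ i, ∑ l, ∑ j, C (d l) * (C (v l i) * C (v l j)) * (z i * z j) :=
        Finset.sum_congr rfl fun i _ => Finset.sum_comm
    _ = ∑ l, ∑ i, ∑ j, C (d l) * (C (v l i) * C (v l j)) * (z i * z j) := Finset.sum_comm
    _ = ∑ l, C (d l) * ((∑ j, C (v l j) * z j) * (∑ j, C (v l j) * z j)) := by
        refine Finset.sum_congr rfl fun l _ => ?_
        rw [Finset.sum_mul_sum, Finset.mul_sum]
        refine Finset.sum_congr rfl fun i _ => ?_
        rw [Finset.mul_sum]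
        exact Finset.sum_congr rfl fun j _ => by ring

/-- The image of a sum of squares under a ring homomorphism is a sum of squares. [folklore] -/
private theorem isSumSq_map {S : Type*} [CommSemiring S] (f : R →+* S) {a : R} (ha : IsSumSq a) :
    IsSumSq (f a) := by
  induction ha with
  | zero => rw [map_zero]; exact IsSumSq.zero
  | sq_add a _ ih => simpa [map_add, map_mul] using IsSumSq.sq_add (f a) ih

/-- If the weights `d_l` are themselves sums of squares in `R` (e.g. squares, or — over `ℚ` — any
nonnegative rational written as a sum of four squares), then `gramPoly (Σ_l d_l • v_l v_lᵀ) z` is a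
sum of squares of polynomials. [cite: PeyrlParrilo2008, §3 proof of Prop. 4] -/
theorem isSumSq_gramPoly_sum_smul_vecMulVec {r : Type*} [Fintype r] {d : r → R}
    (hd : ∀ l, IsSumSq (d l)) (v : r → k → R) (z : k → MvPolynomial σ R) :
    IsSumSq (gramPoly (∑ l, d l • vecMulVec (v l) (v l)) z) := by
  rw [gramPoly_sum_smul_vecMulVec]
  exact IsSumSq.sum fun l _ => IsSumSq.mul (isSumSq_map C (hd l)) (IsSumSq.mul_self _)

end Semiring

/-! ### Soundness: positive semidefinite Gram matrices give nonnegative polynomials -/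

section Ordered

variable [CommRing R] [LinearOrder R] [IsStrictOrderedRing R]

/-- **Weighted-SOS soundness** (the `LDLᵀ` certificate): with nonnegative weights `d_l ≥ 0`,
`gramPoly (Σ_l d_l • v_l v_lᵀ) z` is nonnegative at every point.
[cite: PeyrlParrilo2008, Thm 6 ("Q is positive semidefinite iff all dᵢ are nonnegative")] -/
theorem eval_gramPoly_sum_smul_vecMulVec_nonneg {r : Type*} [Fintype r] {d : r → R}
    (hd : ∀ l, 0 ≤ d l) (v : r → k → R) (z : k → MvPolynomial σ R) (x : σ → R) :
    0 ≤ eval x (gramPoly (∑ l, d l • vecMulVec (v l) (v l)) z) := by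
  rw [gramPoly_sum_smul_vecMulVec, map_sum]
  refine Finset.sum_nonneg fun l _ => ?_
  rw [map_mul, eval_C, map_mul]
  exact mul_nonneg (hd l) (mul_self_nonneg _)

end Ordered

/-- **PSD soundness** (no factorisation needed): over an ordered commutative ring with trivial
involution (`ℚ`, `ℝ`, any ordered field with `star = id`), if `Q` is positive semidefinite then
`gramPoly Q z` is nonnegative at every point, since its value is the quadratic form `z(x)ᵀ Q z(x)`.
[cite: Laurent2008, §3.3 Lemma 3.8 (ii)⇒(i) with §1.3.2] -/
theorem eval_gramPoly_nonneg_of_posSemidef {R : Type v} [CommRing R] [PartialOrder R] [StarRing R]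
    [TrivialStar R] {Q : Matrix k k R} (hQ : Q.PosSemidef) (z : k → MvPolynomial σ R)
    (x : σ → R) : 0 ≤ eval x (gramPoly Q z) := by
  rw [eval_gramPoly]
  simpa only [star_trivial] using hQ.dotProduct_mulVec_nonneg fun i => eval x (z i)

/-- **PSD ⇒ SOS over `ℝ`**: a real positive semidefinite Gram matrix factors as `Q = Bᴴ B = Bᵀ B`,
so `gramPoly Q z` is a sum of squares of real polynomials.
[cite: Laurent2008, §3.3 Lemma 3.8 (ii)⇒(i)] -/
theorem isSumSq_gramPoly_of_posSemidef [DecidableEq k] {Q : Matrix k k ℝ} (hQ : Q.PosSemidef)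
    (z : k → MvPolynomial σ ℝ) : IsSumSq (gramPoly Q z) := by
  obtain ⟨B, -, hB⟩ :=
    (Literature.Analysis.Convex.MatrixStarAlgebra.posSemidef_iff_exists_mem_conjTranspose_mul_self
      (⊤ : StarSubalgebra ℝ (Matrix k k ℝ)) (A := Q) StarSubalgebra.mem_top).1 hQ
  rw [← hB, conjTranspose_eq_transpose_of_trivial]
  exact isSumSq_gramPoly_transpose_mul_self B z

/-! ### The monomial basis and the coefficient system (3.4) -/

section Monomial

variable [CommSemiring R]

/-- The vector of monomials `X^β`, `β ∈ S`, for a finite set `S` of exponents.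
[cite: Laurent2008, §3.3 proof of Lemma 3.8 (the vector z_d)] -/
def monomialVec (S : Finset (σ →₀ ℕ)) : S → MvPolynomial σ R := fun β => monomial β.1 1

/-- The matrix of coefficients of a finite family of polynomials on a finite set of exponents:
`coeffMatrix u S j β = [X^β] u_j` (row `j` = the coefficient vector `vec(u_j)`).
[cite: Laurent2008, §3.3 proof of Lemma 3.8 (u_j = vec(u_j)ᵀ z_d)] -/
def coeffMatrix {ι : Type*} (u : ι → MvPolynomial σ R) (S : Finset (σ →₀ ℕ)) : Matrix ι S R :=
  fun j β => coeff β.1 (u j)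

omit [Fintype k] in
/-- A polynomial supported in `S` is the combination of the monomials of `S` with its coefficients:
`u = Σ_{β ∈ S} ([X^β] u) X^β = vec(u)ᵀ z_S`. [cite: Laurent2008, §3.3 proof of Lemma 3.8] -/
theorem eq_sum_coeff_mul_monomialVec {u : MvPolynomial σ R} {S : Finset (σ →₀ ℕ)}
    (hS : u.support ⊆ S) : u = ∑ β : S, C (coeff β.1 u) * monomialVec S β := by
  change u = ∑ β : S, C (coeff β.1 u) * monomial β.1 (1 : R)
  rw [Finset.sum_coe_sort S fun β => C (coeff β u) * monomial β (1 : R)]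
  conv_lhs => rw [u.as_sum]
  rw [← Finset.sum_subset hS fun β _ hβ => by rw [notMem_support_iff.1 hβ, map_zero, zero_mul]]
  exact Finset.sum_congr rfl fun β _ => by rw [C_mul_monomial, mul_one]

/-- **SOS ⇒ Gram form in the monomial basis**: if every `u_j` is supported in `S`, then
`Σ_j u_j² = z_Sᵀ (Bᵀ B) z_S` with `B = coeffMatrix u S` (so the Gram matrix `Bᵀ B = Σ_j vec(u_j) vec(u_j)ᵀ`
is positive semidefinite). [cite: Laurent2008, §3.3 proof of Lemma 3.8 (i)⇒(ii)] -/
theorem sum_mul_self_eq_gramPoly {ι : Type*} [Fintype ι] (u : ι → MvPolynomial σ R)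
    (S : Finset (σ →₀ ℕ)) (hS : ∀ j, (u j).support ⊆ S) :
    ∑ j, u j * u j = gramPoly ((coeffMatrix u S)ᵀ * coeffMatrix u S) (monomialVec S) := by
  rw [gramPoly_transpose_mul_self]
  refine Finset.sum_congr rfl fun j _ => ?_
  change u j * u j = (∑ β : S, C (coeff β.1 (u j)) * monomialVec S β) *
    ∑ β : S, C (coeff β.1 (u j)) * monomialVec S β
  rw [← eq_sum_coeff_mul_monomialVec (hS j)]

/-- **The linear system (3.4).** The coefficient of `X^α` in `z_Sᵀ Q z_S` is `Σ_{β,γ ∈ S, β+γ=α} Q_{βγ}`;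
so `p = z_Sᵀ Q z_S` is the system of linear equations `Σ_{β+γ=α} Q_{βγ} = p_α` in the entries of
`Q`. [cite: Laurent2008, §3.3 Lemma 3.8 (3.4)] -/
theorem coeff_gramPoly_monomialVec [DecidableEq σ] (S : Finset (σ →₀ ℕ)) (Q : Matrix S S R)
    (α : σ →₀ ℕ) :
    coeff α (gramPoly Q (monomialVec S)) = ∑ β : S, ∑ γ : S, if β.1 + γ.1 = α then Q β γ else 0 := by
  simp only [gramPoly, monomialVec, coeff_sum, coeff_C_mul, monomial_mul, mul_one, coeff_monomial,
    mul_ite, mul_one, mul_zero]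

end Monomial

/-! ### The degree bound: squares cannot cancel at the top -/

section Degree

variable [CommSemiring R]

omit [Fintype k] in
/-- The coefficients of `u` vanish above its total degree (in terms of `Finsupp.degree`).
[folklore] -/
private theorem coeff_eq_zero_of_totalDegree_lt_degree {u : MvPolynomial σ R} {s : σ →₀ ℕ}
    (h : u.totalDegree < s.degree) : coeff s u = 0 := by
  by_contra hne
  exact absurd (le_totalDegree (mem_support_iff.2 hne)) (not_le.2 h)

omit [Fintype k] in
/-- **Top homogeneous components multiply**: if `deg u, deg v ≤ D` then the degree-`2D` component
of `u v` is the product of the degree-`D` components of `u` and `v` (lower components of one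
factor would need a component of degree `> D` of the other to reach `2D`). [folklore] -/
private theorem homogeneousComponent_mul_of_totalDegree_le {u v : MvPolynomial σ R} {D : ℕ}
    (hu : u.totalDegree ≤ D) (hv : v.totalDegree ≤ D) :
    homogeneousComponent (D + D) (u * v) = homogeneousComponent D u * homogeneousComponent D v := by
  classical
  ext s
  rw [coeff_homogeneousComponent, coeff_mul, coeff_mul]
  split_ifs with hs
  · refine Finset.sum_congr rfl fun x hx => ?_
    have hx' : x.1 + x.2 = s := Finset.HasAntidiagonal.mem_antidiagonal.1 hx
    have hdeg : x.1.degree + x.2.degree = D + D := by rw [← map_add, hx', hs]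
    rw [coeff_homogeneousComponent, coeff_homogeneousComponent]
    by_cases h1 : x.1.degree = D
    · have h2 : x.2.degree = D := by omega
      rw [if_pos h1, if_pos h2]
    · rcases lt_or_gt_of_ne h1 with h1 | h1
      · have h2 : D < x.2.degree := by omega
        rw [coeff_eq_zero_of_totalDegree_lt_degree (lt_of_le_of_lt hv h2), mul_zero]
        split_ifs <;> simp
      · rw [coeff_eq_zero_of_totalDegree_lt_degree (lt_of_le_of_lt hu h1), zero_mul]
        split_ifs <;> simp
  · symm
    refine Finset.sum_eq_zero fun x hx => ?_
    have hx' : x.1 + x.2 = s := Finset.HasAntidiagonal.mem_antidiagonal.1 hx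
    rw [coeff_homogeneousComponent, coeff_homogeneousComponent]
    split_ifs with h1 h2
    · exact absurd (by rw [← hx', map_add, h1, h2]) hs
    all_goals simp

omit [Fintype k] in
/-- The top homogeneous component of a nonzero polynomial is nonzero. [folklore] -/
private theorem homogeneousComponent_totalDegree_ne_zero {u : MvPolynomial σ R} (hu : u ≠ 0) :
    homogeneousComponent u.totalDegree u ≠ 0 := by
  classical
  obtain ⟨s, hs, hmax⟩ := Finset.exists_max_image u.support (fun s : σ →₀ ℕ => s.degree)
    (support_nonempty.2 hu)
  have hdeg : s.degree = u.totalDegree := by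
    apply le_antisymm (le_totalDegree hs)
    exact Finset.sup_le fun t ht => hmax t ht
  intro h
  have := congr_arg (coeff s) h
  rw [coeff_homogeneousComponent, if_pos hdeg, coeff_zero] at this
  exact (mem_support_iff.1 hs) this

end Degree

section OrderedField

variable {𝕜 : Type v} [Field 𝕜] [LinearOrder 𝕜] [IsStrictOrderedRing 𝕜]

omit [Fintype k] in
/-- **Over an ordered field a sum of squares of polynomials vanishes only if every square does**
(evaluate: `Σ_j u_j(x)² = 0` forces `u_j(x) = 0` at every point of the infinite field).
[folklore] -/
private theorem eq_zero_of_sum_mul_self_eq_zero {ι : Type*} (s : Finset ι) (u : ι → MvPolynomial σ 𝕜)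
    (h : ∑ j ∈ s, u j * u j = 0) : ∀ j ∈ s, u j = 0 := by
  intro j hj
  haveI : Infinite 𝕜 := CharZero.infinite 𝕜
  apply MvPolynomial.funext
  intro x
  have hx := congr_arg (eval x) h
  rw [map_sum, map_zero] at hx
  have h0 := (Finset.sum_eq_zero_iff_of_nonneg fun i _ => ?_).1 hx j hj
  · rw [map_mul] at h0
    simpa using mul_self_eq_zero.1 h0
  · rw [map_mul]; exact mul_self_nonneg _

omit [Fintype k] in
/-- **Degree bound for SOS decompositions**: over a linearly ordered field, if `p = Σ_j u_j²` then
`2 · deg u_j ≤ deg p` for every `j` — the top-degree forms of the `u_j` of maximal degree `D` have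
`Σ_j (top u_j)² ≠ 0`, which is the degree-`2D` component of `p`.  (So an SOS polynomial of degree
`≤ 2d` is a sum of squares of polynomials of degree `≤ d`, [Laurent2008, Lemma 3.8: "for
polynomials u_j ∈ ℝ[x]_d"].) [cite: Laurent2008, §3.3 Lemma 3.8 (proof)] -/
theorem two_mul_totalDegree_le_of_sum_mul_self_eq {ι : Type*} [Fintype ι]
    (u : ι → MvPolynomial σ 𝕜) {p : MvPolynomial σ 𝕜} (hp : p = ∑ j, u j * u j) (j : ι) :
    2 * (u j).totalDegree ≤ p.totalDegree := by
  classical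
  -- `j₀` of maximal degree `D`
  obtain ⟨j₀, -, hj₀⟩ := Finset.exists_max_image (Finset.univ : Finset ι)
    (fun j => (u j).totalDegree) ⟨j, Finset.mem_univ _⟩
  set D := (u j₀).totalDegree with hD
  have hle : ∀ i, (u i).totalDegree ≤ D := fun i => hj₀ i (Finset.mem_univ _)
  by_cases h0 : u j₀ = 0
  · have : (u j).totalDegree = 0 := by
      have := hle j; rw [hD, h0, totalDegree_zero] at this; omega
    rw [this]; exact Nat.zero_le _
  refine le_trans (Nat.mul_le_mul_left 2 (hle j)) ?_
  by_contra hlt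
  rw [not_le, two_mul] at hlt
  -- the degree-`2D` component of `p` vanishes but equals `Σ (top u_i)²`
  have hcomp : homogeneousComponent (D + D) p = ∑ i, homogeneousComponent D (u i) *
      homogeneousComponent D (u i) := by
    rw [hp, map_sum]
    exact Finset.sum_congr rfl fun i _ => homogeneousComponent_mul_of_totalDegree_le (hle i) (hle i)
  have hzero : ∑ i, homogeneousComponent D (u i) * homogeneousComponent D (u i) = 0 := by
    rw [← hcomp]; exact homogeneousComponent_eq_zero _ _ hlt
  exact homogeneousComponent_totalDegree_ne_zero h0
    (eq_zero_of_sum_mul_self_eq_zero _ _ hzero j₀ (Finset.mem_univ _))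

omit [Fintype k] in
/-- A sum of squares in the sense of `IsSumSq` is a finite sum `Σ_j u_j²`. [folklore] -/
private theorem exists_sum_mul_self_eq_of_isSumSq {A : Type*} [CommSemiring A] {p : A} (hp : IsSumSq p) :
    ∃ (m : ℕ) (u : Fin m → A), p = ∑ j, u j * u j := by
  induction hp with
  | zero => exact ⟨0, Fin.elim0, by simp⟩
  | sq_add a _ ih =>
    obtain ⟨m, u, hu⟩ := ih
    exact ⟨m + 1, Fin.cons a u, by rw [Fin.sum_univ_succ, Fin.cons_zero, hu]; simp⟩

omit [Fintype k] in
/-- Consequently an `IsSumSq` polynomial over an ordered field of degree `≤ 2d` is a finite sum of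
squares of polynomials of degree `≤ d`. [cite: Laurent2008, §3.3 Lemma 3.8 (proof)] -/
theorem exists_sum_mul_self_eq_of_isSumSq_of_totalDegree_le {p : MvPolynomial σ 𝕜}
    (hp : IsSumSq p) {d : ℕ} (hd : p.totalDegree ≤ 2 * d) :
    ∃ (m : ℕ) (u : Fin m → MvPolynomial σ 𝕜),
      p = ∑ j, u j * u j ∧ ∀ j, (u j).totalDegree ≤ d := by
  obtain ⟨m, u, hu⟩ := exists_sum_mul_self_eq_of_isSumSq hp
  refine ⟨m, u, hu, fun j => ?_⟩
  have := two_mul_totalDegree_le_of_sum_mul_self_eq u hu j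
  omega

end OrderedField

/-! ### Monomials of bounded degree and Lemma 3.8 -/

section Bounded

variable (σ) in
/-- The finite set of exponents `β : σ →₀ ℕ` of degree `|β| ≤ d`, for finitely many variables
(the index set `ℕⁿ_d` of the moment / Gram matrices). [cite: Laurent2008, §3.3 Lemma 3.8 (ℕⁿ_d)] -/
def monomialsLE [Fintype σ] [DecidableEq σ] (d : ℕ) : Finset (σ →₀ ℕ) :=
  ((Finset.univ : Finset (σ → Fin (d + 1))).image
      fun f => Finsupp.equivFunOnFinite.symm fun i => (f i : ℕ)).filter
    fun β => β.degree ≤ d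

omit [Fintype k] in
/-- Membership in `monomialsLE σ d` is exactly `|β| ≤ d` (the index set `ℕⁿ_d`).
[cite: Laurent2008, §3.3 Lemma 3.8 (ℕⁿ_d)] -/
theorem mem_monomialsLE [Fintype σ] [DecidableEq σ] {d : ℕ} {β : σ →₀ ℕ} :
    β ∈ monomialsLE σ d ↔ β.degree ≤ d := by
  refine ⟨fun h => (Finset.mem_filter.1 h).2, fun h => Finset.mem_filter.2 ⟨?_, h⟩⟩
  refine Finset.mem_image.2 ⟨fun i => ⟨β i, Nat.lt_succ_of_le ((Finsupp.le_degree i β).trans h)⟩,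
    Finset.mem_univ _, ?_⟩
  ext i
  simp

omit [Fintype k] in
/-- A polynomial of degree `≤ d` is supported in `monomialsLE σ d` (`ℝ[x]_d` is spanned by `z_d`).
[cite: Laurent2008, §3.3 proof of Lemma 3.8] -/
theorem support_subset_monomialsLE [CommSemiring R] [Fintype σ] [DecidableEq σ] {d : ℕ}
    {u : MvPolynomial σ R} (hu : u.totalDegree ≤ d) : u.support ⊆ monomialsLE σ d :=
  fun _ hs => mem_monomialsLE.2 ((le_totalDegree hs).trans hu)

/-- **[Laurent2008, Lemma 3.8] (Recognizing sums of squares), Gram form.**  Let `p ∈ ℝ[x₁,…,xₙ]`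
have degree `≤ 2d` and let `z_d` be the vector of all monomials of degree `≤ d`.  Then `p` is a sum
of squares of polynomials if and only if `p = z_dᵀ Q z_d` for some positive semidefinite matrix `Q`
indexed by `ℕⁿ_d`. [cite: Laurent2008, §3.3 Lemma 3.8] -/
theorem isSumSq_iff_exists_posSemidef [Fintype σ] [DecidableEq σ] {p : MvPolynomial σ ℝ} {d : ℕ}
    (hp : p.totalDegree ≤ 2 * d) :
    IsSumSq p ↔ ∃ Q : Matrix (monomialsLE σ d) (monomialsLE σ d) ℝ,
      Q.PosSemidef ∧ p = gramPoly Q (monomialVec (monomialsLE σ d)) := by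
  constructor
  · intro h
    obtain ⟨m, u, hu, hdeg⟩ := exists_sum_mul_self_eq_of_isSumSq_of_totalDegree_le h hp
    refine ⟨(coeffMatrix u (monomialsLE σ d))ᵀ * coeffMatrix u (monomialsLE σ d), ?_, ?_⟩
    · simpa only [conjTranspose_eq_transpose_of_trivial] using
        posSemidef_conjTranspose_mul_self (coeffMatrix u (monomialsLE σ d))
    · rw [hu]
      exact sum_mul_self_eq_gramPoly u _ fun j => support_subset_monomialsLE (hdeg j)
  · rintro ⟨Q, hQ, rfl⟩
    exact isSumSq_gramPoly_of_posSemidef hQ _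

/-- **[Laurent2008, Lemma 3.8], system form (3.4).**  With the same notation, `p` is a sum of
squares iff the linear system `Σ_{β,γ ∈ ℕⁿ_d, β+γ=α} X_{βγ} = p_α` (all `α`) has a positive
semidefinite solution `X` — a semidefinite feasibility problem. [cite: Laurent2008, §3.3 Lemma 3.8 (ii)] -/
theorem isSumSq_iff_exists_posSemidef_coeff [Fintype σ] [DecidableEq σ] {p : MvPolynomial σ ℝ}
    {d : ℕ} (hp : p.totalDegree ≤ 2 * d) :
    IsSumSq p ↔ ∃ Q : Matrix (monomialsLE σ d) (monomialsLE σ d) ℝ, Q.PosSemidef ∧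
      ∀ α, coeff α p = ∑ β : monomialsLE σ d, ∑ γ : monomialsLE σ d,
        if β.1 + γ.1 = α then Q β γ else 0 := by
  rw [isSumSq_iff_exists_posSemidef hp]
  refine exists_congr fun Q => and_congr_right fun _ => ?_
  simp_rw [← coeff_gramPoly_monomialVec]
  exact ⟨fun h α => by rw [h], fun h => MvPolynomial.ext _ _ h⟩

end Bounded

/-! ### Gram-form Putinar certificates are quadratic-module memberships -/

/-- A Putinar-type certificate written with positive semidefinite Gram matrices over `ℝ`,
`p = z₀ᵀ Q₀ z₀ + Σ_i (zᵢᵀ Qᵢ zᵢ) · gᵢ` with all `Qᵢ ⪰ 0`, exhibits `p` as an element of the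
quadratic module `QM(g)` (each Gram polynomial being a sum of squares); in particular `p ≥ 0` on
`{x | gᵢ(x) ≥ 0 ∀ i}` (`PutinarPositivstellensatz.eval_nonneg_of_mem_quadraticModule`).  This is the
object an SDP-based SOS layer searches for. [cite: Laurent2008, §3.3 Lemma 3.8 with (3.14)–(3.15)] -/
theorem mem_quadraticModule_of_gramPoly {ι : Type*} [Fintype ι] {κ : ι → Type*}
    [∀ i, Fintype (κ i)] [∀ i, DecidableEq (κ i)] [DecidableEq k] (g : ι → MvPolynomial σ ℝ)
    {p : MvPolynomial σ ℝ} {Q₀ : Matrix k k ℝ} (hQ₀ : Q₀.PosSemidef) (z₀ : k → MvPolynomial σ ℝ)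
    {Q : ∀ i, Matrix (κ i) (κ i) ℝ} (hQ : ∀ i, (Q i).PosSemidef) (z : ∀ i, κ i → MvPolynomial σ ℝ)
    (hp : p = gramPoly Q₀ z₀ + ∑ i, gramPoly (Q i) (z i) * g i) :
    p ∈ PutinarPositivstellensatz.quadraticModule g :=
  ⟨gramPoly Q₀ z₀, fun i => gramPoly (Q i) (z i), isSumSq_gramPoly_of_posSemidef hQ₀ z₀,
    fun i => isSumSq_gramPoly_of_posSemidef (hQ i) (z i), hp⟩

/-! ### Tests / usage templates (kernel-checked) -/

section Tests

open PutinarPositivstellensatz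

/-- Test: the Gram factorisation `Q = Bᵀ B`, `B = [[1,1],[0,1]]`, of `Q = [[1,1],[1,2]]` exhibits
`x₀² + 2 x₀ x₁ + 2 x₁² = (x₀ + x₁)² + x₁²` as a sum of squares. [folklore] -/
example : IsSumSq (gramPoly ((!![1, 1; 0, 1] : Matrix (Fin 2) (Fin 2) ℚ)ᵀ * !![1, 1; 0, 1])
    ![(X 0 : MvPolynomial (Fin 2) ℚ), X 1]) :=
  isSumSq_gramPoly_transpose_mul_self _ _

/-- Test: an `LDLᵀ`-type certificate with nonnegative rational pivots proves nonnegativity at every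
rational point. [folklore] -/
example (x : Fin 2 → ℚ) :
    0 ≤ eval x (gramPoly (∑ l : Fin 2, (![2, (3 : ℚ) / 2] l) •
      vecMulVec (![![1, -(1 : ℚ) / 2], ![0, 1]] l) (![![1, -(1 : ℚ) / 2], ![0, 1]] l))
      ![(X 0 : MvPolynomial (Fin 2) ℚ), X 1]) :=
  eval_gramPoly_sum_smul_vecMulVec_nonneg (by intro l; fin_cases l <;> norm_num) _ _ x

end Tests

end Literature.Algebra.Polynomial.GramMatrixMethod
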